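import Summits.Ventures.QEC.Census.CertCheckBZFast
import Summits.Ventures.QEC.Census.CertPopcount
import Summits.Ventures.QEC.Census.CertCheck
import HarnessLib

/-!
# A kernel-fast upper-witness check (`upperOK` without `popc`), with the bridge to type-10's `upperOK`

The upper half of a CSS distance certificate (`Census/CertCheck.lean`, CERT-FORMAT v1 §4 O5 / lemma L2): a word `v` with
zero syndrome and weight `d`, and a non-membership partner `u` in the kernel of the stabilizer rows with odd overlap.
`upperOK n Hsyn Hstab d v u` tests this with the bit-serial `popc n` on every row (`synZero`), which the kernel evaluates in
≈ 23 s at `n = 144` but ≈ 360 s at `n = 288` (gate timings of the `[[144,12,12]]` / `[[288,12,18]]` witness files) and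
does not finish in 900 s at `n = 360` — `popc` on a hot path, against the advice of `Census/CertCheckBZFast.lean`
(qec-type-08: "never put `popc` on a hot path"). This file gives the SAME check in the fast idiom of that file
(Kernighan steps `kstep`/`kiter` by the primitive recursor, raw `Nat.land`/`Nat.beq`, no typeclass unfolding) and PROVES
that it implies `upperOK`, so `upper_sound` applies verbatim:

* `oddK F x` — parity of the bit count of `x` by at most `F` lowest-set-bit clearings (`oddK_iff`: correct whenever
  `kiter F x = 0`, i.e. `x` has at most `F` set bits);
* `evenAndK F h v`, `synZeroK F H v` — every row of `H` has even overlap with `v` (row overlaps of at most `F` bits;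
  for LDPC rows take `F` = the row weight); `synZero_of_synZeroK`;
* `wtEqK d v` — weight exactly `d` by two Kernighan tests (`wtGtF (d−1)` and not `wtGtF d`); `popc_eq_of_wtEqK`;
* **`upperFastOK F n Hsyn Hstab d v u`** and **`upperOK_of_upperFastOK`** — hence
  `upper_sound (upperOK_of_upperFastOK h)`; cost `O(|H| · F + d + F)` word operations instead of `O(|H| · n)` bit steps;
* control: the `[[4,2,2]]` `Z`-witness `0011` with partner `0101` (CERT-REQS A1 shape), by `decide`.

Consumer: `Census/BB/BB360Claim.lean` (`d (BB.bb360) ≤ 24`). HONEST FRAMING: a re-expression of an existing check plus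
its bridge; certifies nothing by itself; all proved, axioms standard, no `native_decide`.
-/

namespace Summit.Ventures.QEC.Census

open Matrix Literature.InformationTheory.QuantumCodes

/-! ## The words -/

/-- Parity of the number of set bits of `x`, by Kernighan steps with fuel `F` (primitive recursor, raw operations):
`false` on `0`, else the negation of the parity of `kstep x`. Meaningful when `kiter F x = 0`. (definition) -/
noncomputable def oddK (F x : ℕ) : Bool :=
  Nat.rec (motive := fun _ => ℕ → Bool) (fun _ => false)
    (fun _ f y => cond (Nat.beq y 0) false (!(f (kstep y)))) F x

/-- `oddK 0 x = false`. -/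
theorem oddK_zero (x : ℕ) : oddK 0 x = false := rfl

/-- `oddK (F+1) x = if x = 0 then false else ¬ oddK F (kstep x)`. -/
theorem oddK_succ (F x : ℕ) : oddK (F + 1) x = cond (Nat.beq x 0) false (!(oddK F (kstep x))) := rfl

/-- `evenAndK F h v`: the overlap `h ∧ v` empties within `F` Kernighan steps and has an even number of set bits.
(definition) -/
noncomputable def evenAndK (F h v : ℕ) : Bool :=
  Nat.beq (kiter F (Nat.land h v)) 0 && !(oddK F (Nat.land h v))

/-- Fast `synZero`: every row of `H` passes `evenAndK F · v` (primitive list recursor). (definition) -/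
noncomputable def synZeroK (F : ℕ) (H : List ℕ) (v : ℕ) : Bool :=
  List.rec (motive := fun _ => Bool) true (fun h _ r => evenAndK F h v && r) H

/-- Weight exactly `d`: (`d = 0` or more than `d − 1` set bits) and not more than `d` set bits, with type-08's fast
Kernighan test `wtGtF`. (definition) -/
noncomputable def wtEqK (d v : ℕ) : Bool :=
  (Nat.beq d 0 || wtGtF (d - 1) v) && !(wtGtF d v)

/-- **The fast upper-witness check**: `v, u < 2ⁿ`; zero `Hsyn`-syndrome of `v` and weight `d`; zero `Hstab`-syndrome of
`u`; odd overlap of `u` and `v` — all by Kernighan steps with fuel `F` (row overlaps and `u ∧ v` must have at most `F`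
set bits for the check to pass). (definition) -/
noncomputable def upperFastOK (F n : ℕ) (Hsyn Hstab : List ℕ) (d v u : ℕ) : Bool :=
  Nat.blt v (2 ^ n) && Nat.blt u (2 ^ n) && synZeroK F Hsyn v && wtEqK d v && synZeroK F Hstab u &&
    (Nat.beq (kiter F (Nat.land u v)) 0 && oddK F (Nat.land u v))

/-! ## Soundness: the fast words imply type-10's `upperOK` -/

section Sound

variable {n : ℕ}

/-- `kiter` preserves `< 2ⁿ`. -/
theorem kiter_lt_two_pow : ∀ (F : ℕ) {x : ℕ}, x < 2 ^ n → kiter F x < 2 ^ n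
  | 0, _, hx => hx
  | F + 1, x, hx => by
    rw [kiter_succ]
    exact kiter_lt_two_pow F (lt_of_le_of_lt Nat.and_le_left hx)

/-- **`oddK` computes the parity** of the bit count whenever the fuel suffices (`kiter F x = 0`). -/
theorem oddK_iff : ∀ (F : ℕ) {x : ℕ}, x < 2 ^ n → kiter F x = 0 → (oddK F x = true ↔ popc n x % 2 = 1)
  | 0, x, _, hk => by
    have hx0 : x = 0 := by simpa [kiter_zero] using hk
    subst hx0
    simp [oddK_zero, popc_zero]
  | F + 1, x, hx, hk => by
    rw [oddK_succ]
    by_cases hx0 : x = 0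
    · subst hx0
      simp [popc_zero]
    · have hb : Nat.beq x 0 = false := by
        cases h : Nat.beq x 0
        · rfl
        · exact absurd (Nat.eq_of_beq_eq_true h) hx0
      rw [hb, cond_false, kiter_succ] at *
      have hlt : kstep x < 2 ^ n := lt_of_le_of_lt Nat.and_le_left hx
      have ih := oddK_iff F hlt hk
      have hstep := popc_and_pred n hx0 hx
      rw [← kstep_eq] at hstep
      rw [Bool.not_eq_true', ← Bool.not_eq_true, ih]
      omega

/-- A passing `evenAndK` row has even overlap (bit-count form). -/
theorem popc_and_even_of_evenAndK {F h v : ℕ} (hv : v < 2 ^ n) (he : evenAndK F h v = true) :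
    popc n (h &&& v) % 2 = 0 := by
  simp only [evenAndK, Bool.and_eq_true, Nat.beq_eq, Bool.not_eq_true'] at he
  have hlt : h &&& v < 2 ^ n := lt_of_le_of_lt Nat.and_le_right hv
  have h2 : oddK F (h &&& v) = false := he.2
  have hiff := oddK_iff F hlt he.1
  rw [h2] at hiff
  have : ¬ (popc n (h &&& v) % 2 = 1) := fun hp => Bool.false_ne_true (hiff.2 hp)
  omega

/-- **Fast syndrome ⇒ syndrome**: `synZeroK F H v ⇒ synZero n H v` for `v < 2ⁿ`. -/
theorem synZero_of_synZeroK {F v : ℕ} (hv : v < 2 ^ n) : ∀ (H : List ℕ), synZeroK F H v = true → synZero n H v = true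
  | [], _ => by simp [synZero]
  | h :: t, hs => by
    have hs' : evenAndK F h v = true ∧ synZeroK F t v = true := by
      simpa [synZeroK, Bool.and_eq_true] using hs
    have ht := synZero_of_synZeroK hv t hs'.2
    simp only [synZero, List.all_cons, Bool.and_eq_true, beq_iff_eq, List.all_eq_true] at ht ⊢
    exact ⟨popc_and_even_of_evenAndK hv hs'.1, ht⟩

/-- **Exact weight from the two Kernighan tests**: `wtEqK d v ⇒ popc n v = d` for `v < 2ⁿ`. -/
theorem popc_eq_of_wtEqK {d v : ℕ} (hv : v < 2 ^ n) (h : wtEqK d v = true) : popc n v = d := by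
  simp only [wtEqK, Bool.and_eq_true, Bool.or_eq_true, Nat.beq_eq, Bool.not_eq_true', wtGtF_eq] at h
  obtain ⟨h1, h2⟩ := h
  have hle : popc n v ≤ d := by
    by_contra hlt
    have := wtGt_of_lt_popc n d v hv (by omega)
    rw [h2] at this
    exact Bool.false_ne_true this
  rcases h1 with h0 | hgt
  · subst h0; omega
  · have := lt_popc_of_wtGt n (d - 1) v hv hgt
    omega

/-- **The fast check implies type-10's `upperOK`** (same `n, Hsyn, Hstab, d, v, u`), so `upper_sound` applies. -/
theorem upperOK_of_upperFastOK {F : ℕ} {Hsyn Hstab : List ℕ} {d v u : ℕ}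
    (h : upperFastOK F n Hsyn Hstab d v u = true) : upperOK n Hsyn Hstab d v u = true := by
  simp only [upperFastOK, Bool.and_eq_true, Nat.blt_eq, Nat.beq_eq] at h
  obtain ⟨⟨⟨⟨⟨hv, hu⟩, hsv⟩, hwt⟩, hsu⟩, hk, hodd⟩ := h
  have huv : u &&& v < 2 ^ n := lt_of_le_of_lt Nat.and_le_right hv
  have hpar : popc n (u &&& v) % 2 = 1 := (oddK_iff F huv hk).1 hodd
  simp only [upperOK, Bool.and_eq_true, beq_iff_eq]
  exact ⟨⟨⟨synZero_of_synZeroK hv Hsyn hsv, popc_eq_of_wtEqK hv hwt⟩, synZero_of_synZeroK hu Hstab hsu⟩, hpar⟩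

/-- **Upper bound (L2), fast form**: a passing fast witness is a logical operator of weight `d` outside the stabilizer
row space (type-10's `upper_sound` through the bridge). -/
theorem upper_sound_fast {F : ℕ} {Hsyn Hstab : List ℕ} {d v u : ℕ} (h : upperFastOK F n Hsyn Hstab d v u = true) :
    rowMatrix n Hsyn *ᵥ ofBits n v = 0 ∧ ofBits n v ∉ rowSpace (rowMatrix n Hstab) ∧
      hammingNorm (ofBits n v) = d :=
  upper_sound (upperOK_of_upperFastOK h)

end Sound

/-! ## Control (tier KERNEL, `decide`) -/

/-- Control (CERT-REQS A1 shape): on the `[[4,2,2]]` code (`H^X = H^Z = 1111`) the `Z`-logical `0011` (weight 2) with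
partner `0101` passes the fast check with fuel `4`. -/
theorem upperFastOK_control422 : upperFastOK 4 4 [15] [15] 2 3 5 = true := by decide

/-- … and the bridge delivers type-10's check on the same data. -/
theorem upperOK_control422 : upperOK 4 [15] [15] 2 3 5 = true := upperOK_of_upperFastOK upperFastOK_control422

/-- A wrong witness is rejected: `0111` has odd overlap with the check row. -/
theorem upperFastOK_control422_bad : upperFastOK 4 4 [15] [15] 3 7 5 = false := by decide

end Summit.Ventures.QEC.Census
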